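import Summits.Schanuel.Schanuel.Theorems.RootDecomp1KTrinomialDescent04

/-!
# RootDecomp1KTrinomialDescent — lens 1, generation 64, NODE 25 «TRINOMIAL (FERMAT-QUOTIENT) DESCENT ON THE K-LINE — the curve X3 decided: EMPTY AT EVERY LEVEL» (×0-as-record under RULE K-R51 (i): for every trinomial σ₀Y^d + σ₁2^s·x^i·Y^k + σ₂x^j with Δ = (d−k)(j−i) − i·k odd ≥ 3 and primitive inner edges — the class FermatTri — NO rational point over any dyadic x = p/2^n, p odd, |p| ≠ 1, n ≥ 1, hence no level point for N ≥ 2 ⇒ LevelFinite / ThinFibreAt ∀ m₀ / BddLevelEmpty; X3 = x³ + Y·x + Y⁷ EMPTY at every level N ≥ 0; elementary: unique factorisation + parity; CLAIM L2956, PRICE L2959 (β), ERRATUM E3, RULE K-R56) — continuation (RootDecomp1KTrinomialDescent05): §T territory: xdeg_X3P, not_domSuper_X3P, not_domHyper_X3P, den_of_level_X3P, the class boundary not_fermatTri_of_two_coeffs, the nominee X5P typed as a non-member (section Territory); §N sharpness (section Sharpness)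

(lens-1 g64 NODE 25 «TRINOMIAL (FERMAT-QUOTIENT) DESCENT ON THE K-LINE — the curve X3 decided: EMPTY AT EVERY LEVEL» L2968: HOME kernel K = HOME/decomp-schanuel-lens-1/g64/lean/TrinomialDescent.lean sha256 e7961d57…, 1095 l, 95 decls, ONE namespace `Summit.Schanuel.Schanuel.Theorems.RootDecomp1KTrinomialDescent`, imports the tree port …RootDecomp1KSuperellipticSiegel06 ONLY; no private, no instance, no set_option, no notation, no sorry, no decide; lens farm: K rc 0 · 0 errors · 0 sorries, Probe rc 0 (155 `#print axioms` guards ⊆ the standard triple), Ctrl0 rc 0, Ctrl rc 1 = 35 planted errors exactly; CLAIM L2956 (ASK-FIRST under K-R55 (iii)); crit g12 PRICE L2959: RULING (β) ×0-AS-RECORD under RULE K-R51 (i) (descent lane: Chevalley–Weil along the étale μ₁₁-torsor defined by the ℚ-rational cuspidal 11-torsion of J_X3 + an elementary step upstairs) — «BUILD, ×0 VERDICT and RECORD PORT WELCOME AND REQUESTED»; ERRATUM E3 (critic's: X3 is NOT open territory — STRUCK as standing witness); RULE K-R56 PRE-ANNOUNCED; CHECKLIST K-g64 (1)–(9); census LIVENESS-v31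 (keys tri / cusp / jac of record L2969: FermatTri YES on X3 only, cuspidal group of order 11, census kit jac: #J_X3(𝔽_p) for p = 5, 13, 23 has gcd exactly 11); writer g34 NOTE 4 L2960 (pre-check 15/15 + 5/5); critic VERDICT: VERIFIED, OF RECORD: ×0-AS-RECORD under RULE K-R51 (i) (the descent lane; no credit class), VERDICT L2971 (crit-1 g12, 2026-09-02T00:18Z): CHECKLIST K-g64 (1)–(9) met item by item on the critic's own farm runs (K rc 0 · 0 errors · 0 sorries; Probe rc 0 with 155 `#print axioms` closures ⊆ the standard triple; Ctrl0 rc 0; Ctrl rc 1 = exactly the 35 planted errors; Pin25.lean 25/25); tally of record UNCHANGED lens-1 ×21 + THEOREM ×23; ERRATUM E3 FINAL (X3 = x³ + Y·x + Y⁷ STRUCK as standing witness: J_X3(ℚ)[11] ∋ [P₁ − P_∞] cuspidal; census jac gcd = 11 at p = 5, 13, 23); RULE K-R56 FIXED (+ the (d2) precision and GLOSS); PORT GO L2973 (×0 RECORD port, census-1; `--supports stmt-Schanuel-33364`, the item stays OPEN). Port by census-1 gen 24 as `RootDecomp1KTrinomialDescent01–05` (`--supports stmt-Schanuel-33364`;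 the item stays OPEN; ×0 record port, no credit anywhere): 01 = §A arithmetic part 1 (section Arithmetic: L1 parity lemmas `odd_geom_sum₂` / `le_geom_sum₂` / `pow_ne_pow_add_two_pow` / `eq_one_of_pow_add_pow_eq_two_pow` / `pow_ne_pow_add_two_pow_both`, valuations, perfect powers; section Arithmetic closed at the cut); 02 = §A part 2 (section Arithmetic re-opened: section Core — `perPrime`, `trinomial_core`); 03 = §B the term `triP` and the class `def FermatTri` (section Trinomial) + §C (M1) the 2-adic descent `den_of_root_triP` / `bev_triP_ne_zero_of_dyadic` (section TwoAdic) + §D the K-line doors `no_level_of_fermatTri` / `levelFinite_of_fermatTri` / `thinFibreAt_of_fermatTri` / `bddLevelEmpty_of_fermatTri` (section KLine); 04 = §F the term of record `X3P` (`bev_X3P`, `fermatTri_X3P`, `no_level_X3P`, `levelSet_X3P_eq_empty`, `levelFinite_X3P`, `thinFibreAt_X3P`, `bddLevelEmpty_X3P`) and the family `FT` (section Witness); 05 = §T territory refusals by tree names (`xdeg_X3P`, `not_domSuper_X3P`, `not_domHyper_X3P`, `den_of_level_X3P`, the class boundary `not_fermatTri_of_two_coeffs`, the nominee `X5P` typed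 as a NON-member) (section Territory) + §N sharpness (section Sharpness). Text = K VERBATIM (every declaration documented by the lens; statements and proofs unchanged; K's module docstring kept in part 01 below this provenance block).)
-/

noncomputable section

namespace Summit.Schanuel.Schanuel.Theorems.RootDecomp1KTrinomialDescent

open Polynomial Finset
open LiouvilleNumber
open scoped Nat
open Summit.Schanuel.Schanuel.Theorems.RootDecomp1KDegreeLadder
open Summit.Schanuel.Schanuel.Theorems.RootDecomp1KXTop
open Summit.Schanuel.Schanuel.Theorems.RootDecomp1KXAll
open Summit.Schanuel.Schanuel.Theorems.RootDecomp1KLevelFinite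
open Summit.Schanuel.Schanuel.Theorems.RootDecomp1KHeightGrading (BddLevelEmpty bddLevelEmpty_iff_levelFinite H17P h17C
  h17C_one)
open Summit.Schanuel.Schanuel.Theorems.RootDecomp1KOddEmpty (levelFinite_of_no_level W4P w4C)
open Summit.Schanuel.Schanuel.Theorems.RootDecomp1KTwoBaseCell (psNumer partialSum_eq_psNumer_div coprime_psNumer)
open Summit.Schanuel.Schanuel.Theorems.RootDecomp1KRelLiouvilleCell (partialSum_two_zero)
open Summit.Schanuel.Schanuel.Theorems.RootDecomp1KRunge (psNumer_pos_runge RW rwC rwC_four)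
open Summit.Schanuel.Schanuel.Theorems.RootDecomp1KSuperellipticSiegel (DomSuper exists_root_septic T tC A xCoeff_T
  tC_zero coeff_A_seven coeff_A_zero twoTermC twoTermP_eq_xPolyP)
open Summit.Schanuel.Schanuel.Theorems.RootDecomp1KHyperellipticSiegel (DomHyper)

/-! ## §T  TERRITORY: where `X3` sits (non-lacunary ⇒ outside `DomSuper`; `xdeg 3` ⇒ outside `DomHyper`) -/

section Territory

variable {P : ℤ[X][X]}

/-- `: xdeg X3P = 3`. -/
theorem xdeg_X3P : xdeg X3P = 3 := xdeg_xPolyP 3 x3C (by simp)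

/-- the MIDDLE coefficient `xCoeff X3P 1 = Y ≠ 0`: `X3` is NOT lacunary. -/
theorem xCoeff_X3P_one : xCoeff X3P 1 = X := by
  rw [X3P, xCoeff_xPolyP, if_pos (by norm_num), x3C_one]

/-- `: xCoeff X3P 1 ≠ 0`. -/
theorem xCoeff_X3P_one_ne_zero : xCoeff X3P 1 ≠ 0 := by
  rw [xCoeff_X3P_one]; exact X_ne_zero

/-- `X3 ∉ DomSuper` (node 24's class is LACUNARY: `xCoeff P 1 = 0`). -/
theorem not_domSuper_X3P : ¬ DomSuper X3P := fun h =>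
  xCoeff_X3P_one_ne_zero (h.2.1 1 le_rfl (by rw [xdeg_X3P]; norm_num))

/-- `X3 ∉ DomHyper` (node 23's class has `xdeg P = 2`). -/
theorem not_domHyper_X3P : ¬ DomHyper X3P := fun h => by
  have := h.1; rw [xdeg_X3P] at this; omega

/-- **THE TERRITORY CERTIFICATE OF `X3`** (one conjunction): member of the class; `xdeg 3`; non-lacunary; outside
`DomSuper` and `DomHyper`; real-live at every level; every fibre non-degenerate; NO rational point at ANY level; every
level set EMPTY; `LevelFinite`; `ThinFibreAt m₀` for every `m₀`; `BddLevelEmpty`. -/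
theorem X3P_territory : FermatTri X3P ∧ xdeg X3P = 3 ∧ xCoeff X3P 1 ≠ 0 ∧ ¬ DomSuper X3P ∧ ¬ DomHyper X3P ∧
    (∀ N : ℕ, ∃ y : ℝ, bev X3P (partialSum 2 N) y = 0) ∧ (∀ r : ℚ, ∃ x : ℝ, bev X3P x (r : ℝ) ≠ 0) ∧
    (∀ (N : ℕ) (r : ℚ), bev X3P (partialSum 2 N) r ≠ 0) ∧ (∀ C : ℝ, LevelSet X3P C = ∅) ∧ LevelFinite X3P ∧
    (∀ m₀ : ℕ, ThinFibreAt m₀ X3P) ∧ BddLevelEmpty X3P :=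
  ⟨fermatTri_X3P, xdeg_X3P, xCoeff_X3P_one_ne_zero, not_domSuper_X3P, not_domHyper_X3P, X3P_real_live,
    X3P_nondegenerate, no_level_X3P, levelSet_X3P_eq_empty, levelFinite_X3P, thinFibreAt_X3P, bddLevelEmpty_X3P⟩

/-! ### the class boundary, typed: every `x`-coefficient of a member is a MONOMIAL in `Y` -/

/-- the support of a trinomial: a non-vanishing coefficient of `x^j·Y^u` is one of the three monomials. -/
theorem support_triP {σ₀ a σ₂ : ℤ} {m i k l u j : ℕ} (h : ((triP σ₀ a σ₂ m i k l).coeff u).coeff j ≠ 0) :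
    (u = m + k ∧ j = 0) ∨ (u = k ∧ j = i) ∨ (u = 0 ∧ j = l + i) := by
  by_contra hc
  have c1 : u = m + k → j ≠ 0 := fun h1 hj => hc (Or.inl ⟨h1, hj⟩)
  have c2 : u = k → j ≠ i := fun h2 hj => hc (Or.inr (Or.inl ⟨h2, hj⟩))
  have c3 : u = 0 → j ≠ l + i := fun h3 hj => hc (Or.inr (Or.inr ⟨h3, hj⟩))
  apply h
  simp only [triP, coeff_add, Polynomial.coeff_C_mul_X_pow, Polynomial.coeff_C]
  have e1 : ((if u = m + k then C σ₀ else 0 : ℤ[X])).coeff j = 0 := by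
    split_ifs with h1
    · rw [Polynomial.coeff_C, if_neg (c1 h1)]
    · rfl
  have e2 : ((if u = k then C a * X ^ i else 0 : ℤ[X])).coeff j = 0 := by
    split_ifs with h2
    · rw [Polynomial.coeff_C_mul, Polynomial.coeff_X_pow, if_neg (c2 h2), mul_zero]
    · rfl
  have e3 : ((if u = 0 then C σ₂ * X ^ (l + i) else 0 : ℤ[X])).coeff j = 0 := by
    split_ifs with h3
    · rw [Polynomial.coeff_C_mul, Polynomial.coeff_X_pow, if_neg (c3 h3), mul_zero]
    · rfl
  rw [e1, e2, e3, add_zero, add_zero]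

/-- for a trinomial with `0 < i`, `0 < l`, every `x`-coefficient `xCoeff _ j` is a MONOMIAL in `Y`: two distinct
non-vanishing `Y`-coefficients never occur. -/
theorem eq_of_coeff_xCoeff_triP_ne_zero {σ₀ a σ₂ : ℤ} {m i k l : ℕ} (hi : 0 < i) (hl : 0 < l) {j u v : ℕ}
    (hu : (xCoeff (triP σ₀ a σ₂ m i k l) j).coeff u ≠ 0) (hv : (xCoeff (triP σ₀ a σ₂ m i k l) j).coeff v ≠ 0) :
    u = v := by
  rw [coeff_xCoeff] at hu hv
  rcases support_triP hu with ⟨hu1, hu2⟩ | ⟨hu1, hu2⟩ | ⟨hu1, hu2⟩ <;>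
    rcases support_triP hv with ⟨hv1, hv2⟩ | ⟨hv1, hv2⟩ | ⟨hv1, hv2⟩ <;> omega

/-- **THE CLASS BOUNDARY INSTRUMENT**: for `P ∈ FermatTri`, two distinct `Y`-coefficients of one `x`-coefficient
`xCoeff P j` are never both non-zero. -/
theorem eq_of_fermatTri (hP : FermatTri P) {j u v : ℕ} (hu : (xCoeff P j).coeff u ≠ 0)
    (hv : (xCoeff P j).coeff v ≠ 0) : u = v := by
  obtain ⟨σ₀, σ₁, σ₂, s, m, i, k, l, Δ, -, -, -, hi, -, hΔ, -, hΔ3, -, -, rfl⟩ := hP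
  have hl : 0 < l := by
    rcases Nat.eq_zero_or_pos l with h0 | h0
    · rw [h0, zero_mul] at hΔ; omega
    · exact h0
  exact eq_of_coeff_xCoeff_triP_ne_zero hi hl hu hv

/-- … so a curve with an `x`-coefficient carrying TWO non-zero `Y`-coefficients is NOT in the class. -/
theorem not_fermatTri_of_two_coeffs {j u v : ℕ} (huv : u ≠ v) (hu : (xCoeff P j).coeff u ≠ 0)
    (hv : (xCoeff P j).coeff v ≠ 0) : ¬ FermatTri P :=
  fun hP => huv (eq_of_fermatTri hP hu hv)

/-- the standing witness **`W4 = (Y⁴−17)x² + (Y³+1)x + (Y+2)`** (non-dominant sector) is NOT a member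
(`xCoeff W4P 0 = Y + 2`): W4 is NOT reached — HONEST. -/
theorem not_fermatTri_W4P : ¬ FermatTri W4P := by
  have h : (xCoeff W4P 0).coeff 0 = 2 ∧ (xCoeff W4P 0).coeff 1 = 1 := by
    rw [W4P, xCoeff_xPolyP, if_pos (Nat.zero_le _)]; simp [w4C]
  exact not_fermatTri_of_two_coeffs zero_ne_one (by rw [h.1]; norm_num) (by rw [h.2]; norm_num)

/-- node 24's family **`T j = x³ − (Y⁷ + (4j+2)(Y−1))`** is NOT in the class (`xCoeff (T j) 0` has `Y⁰` and `Y⁷`). -/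
theorem not_fermatTri_T (j : ℤ) : ¬ FermatTri (T j) := by
  have h : (xCoeff (T j) 0).coeff 0 = 4 * j + 2 ∧ (xCoeff (T j) 0).coeff 7 = -1 := by
    rw [xCoeff_T, tC_zero, coeff_neg, coeff_neg, coeff_A_zero, coeff_A_seven]; constructor <;> ring
  exact not_fermatTri_of_two_coeffs (by norm_num : (0 : ℕ) ≠ 7) (by rw [h.1]; omega) (by rw [h.2]; norm_num)

/-- node 12's **`H17P = x³(Y²−17)² + x²·Y + x·(Y+1) + Y⁵`** is NOT in the class (`xCoeff H17P 1 = Y + 1`). -/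
theorem not_fermatTri_H17P : ¬ FermatTri H17P := by
  have h : (xCoeff H17P 1).coeff 0 = 1 ∧ (xCoeff H17P 1).coeff 1 = 1 := by
    rw [H17P, xCoeff_xPolyP, if_pos (by norm_num), h17C_one]
    simp only [coeff_add, Polynomial.coeff_X_zero, Polynomial.coeff_X_one, Polynomial.coeff_C]
    norm_num
  exact not_fermatTri_of_two_coeffs zero_ne_one (by rw [h.1]; norm_num) (by rw [h.2]; norm_num)

/-- node 18's Runge rows **`RW w`** (`x`-degree 5, `xCoeff (RW w) 4 = Y³ + Y + 1`) are NOT in the class. -/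
theorem not_fermatTri_RW (w : ℤ[X]) : ¬ FermatTri (RW w) := by
  have h : (xCoeff (RW w) 4).coeff 0 = 1 ∧ (xCoeff (RW w) 4).coeff 1 = 1 := by
    rw [RW, xCoeff_xPolyP, if_pos (by norm_num), rwC_four]
    simp only [coeff_add, Polynomial.coeff_X_pow, Polynomial.coeff_X, Polynomial.coeff_one]
    norm_num
  exact not_fermatTri_of_two_coeffs zero_ne_one (by rw [h.1]; norm_num) (by rw [h.2]; norm_num)

/-- the record's two-term cubic **`quartP = x³(Y⁴ + Y) − 2`** is NOT in the class (`xCoeff quartP 3 = Y⁴ + Y`). -/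
theorem not_fermatTri_quartP : ¬ FermatTri quartP := by
  have h : (xCoeff quartP 3).coeff 1 = 1 ∧ (xCoeff quartP 3).coeff 4 = 1 := by
    rw [quartP, twoTermP_eq_xPolyP (by norm_num), xCoeff_xPolyP, if_pos le_rfl]
    simp [twoTermC, Polynomial.coeff_X_pow, Polynomial.coeff_X]
  exact not_fermatTri_of_two_coeffs (by norm_num : (1 : ℕ) ≠ 4) (by rw [h.1]; norm_num) (by rw [h.2]; norm_num)

/-- [term] the critic's NOMINEE for the vacant witness slot of K-R56 (ii) (PRICE L2959 (4), under certification, NOT of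
record): **`X5P = x³ + Y·x + Y⁷ + 2`** (`c₃ = 1`, `c₁ = Y`, `c₀ = Y⁷ + 2`). -/
def x5C : ℕ → ℤ[X] := fun i => if i = 3 then 1 else if i = 1 then X else if i = 0 then X ^ 7 + C 2 else 0

/-- [term] `X5P := xPolyP 3 x5C`. -/
def X5P : ℤ[X][X] := xPolyP 3 x5C

/-- `(x y : ℝ) : bev X5P x y = x ^ 3 + x * y + y ^ 7 + 2`. -/
@[simp] theorem bev_X5P (x y : ℝ) : bev X5P x y = x ^ 3 + x * y + y ^ 7 + 2 := by
  have h : bev X5P x y = y ^ 7 + 2 + x * y + x ^ 3 := by simp [X5P, x5C, Finset.sum_range_succ, map_ofNat]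
  rw [h]; ring

/-- `: xdeg X5P = 3`. -/
theorem xdeg_X5P : xdeg X5P = 3 := xdeg_xPolyP 3 x5C (by simp [x5C])

/-- `X5` is NOT in the class (FOUR monomials: `xCoeff X5P 0 = Y⁷ + 2`), NOT lacunary (`xCoeff X5P 1 = Y`), hence outside
`DomSuper`, and outside `DomHyper` (`xdeg 3`) — node 25 does NOT reach the nominee (HONEST). -/
theorem not_fermatTri_X5P : ¬ FermatTri X5P := by
  have h : (xCoeff X5P 0).coeff 0 = 2 ∧ (xCoeff X5P 0).coeff 7 = 1 := by
    rw [X5P, xCoeff_xPolyP, if_pos (Nat.zero_le _)]; simp [x5C, Polynomial.coeff_X_pow]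
  exact not_fermatTri_of_two_coeffs (by norm_num : (0 : ℕ) ≠ 7) (by rw [h.1]; norm_num) (by rw [h.2]; norm_num)

/-- `: xCoeff X5P 1 = X`. -/
theorem xCoeff_X5P_one : xCoeff X5P 1 = X := by
  rw [X5P, xCoeff_xPolyP, if_pos (by norm_num)]; simp [x5C]

/-- `: ¬ DomSuper X5P`. -/
theorem not_domSuper_X5P : ¬ DomSuper X5P := fun h => by
  have h1 := h.2.1 1 le_rfl (by rw [xdeg_X5P]; norm_num)
  rw [xCoeff_X5P_one] at h1
  exact X_ne_zero h1

/-- `: ¬ DomHyper X5P`. -/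
theorem not_domHyper_X5P : ¬ DomHyper X5P := fun h => by
  have := h.1; rw [xdeg_X5P] at this; omega

end Territory

/-! ## §N  SHARPNESS: each hypothesis of the dyadic theorem is load-bearing (typed rational points) -/

section Sharpness

/-- `|p| ≠ 1` is needed: `Y³ + x·Y + x³ = FT 2 2 ∈ FermatTri` (`Δ = 3`) passes through `(−1/2, −1/2)`. -/
theorem sharp_abs_ne_one : bev (FT 2 2) (((-1 : ℤ) : ℝ) / 2 ^ 1) ((-1 / 2 : ℚ) : ℝ) = 0 := by
  rw [bev_FT]; push_cast; norm_num

/-- `2 ≤ N` is needed on the K-line: `Y⁵ + 2x·Y² − x⁴ = triP 1 2 (−1) 3 1 2 3 ∈ FermatTri` (`Δ = 7`) has the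
level-`1` point `(s_1, −1) = (1, −1)`. -/
theorem sharp_level_one : bev (triP 1 2 (-1) 3 1 2 3) (partialSum 2 1) ((-1 : ℚ) : ℝ) = 0 := by
  have e : partialSum 2 1 = 1 := by simp [partialSum, Finset.sum_range_succ]; norm_num
  rw [e, bev_triP]; push_cast; norm_num

/-- `: FermatTri (triP 1 2 (-1) 3 1 2 3)`. -/
theorem fermatTri_sharp_level_one : FermatTri (triP 1 2 (-1) 3 1 2 3) := by
  have h := fermatTri_triP (Or.inl rfl) (Or.inl rfl) (Or.inr rfl) (s := 1) (m := 3) (l := 3) (Δ := 7) one_pos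
    two_pos (by norm_num) (by norm_num) (by norm_num) (by norm_num) (by norm_num)
  rwa [pow_one, one_mul] at h

/-- `Δ` ODD is needed: `Y² + 8x·Y − x⁴ = triP 1 8 (−1) 1 1 1 3` (`a = 2³`, `Δ = 2`, primitive edges) passes
through `(15/2, 135/4)`, `|p| = 15`. -/
theorem sharp_delta_odd : bev (triP 1 8 (-1) 1 1 1 3) (((15 : ℤ) : ℝ) / 2 ^ 1) ((135 / 4 : ℚ) : ℝ) = 0 := by
  rw [bev_triP]; push_cast; norm_num

/-- … and the PRICE's even-`Δ` control: `Y² + x·Y − x⁴ = triP 1 1 (−1) 1 1 1 3` (`Δ = 2`, `a = 1`, primitive edges)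
passes through `(3/8, −27/64)` (and `(3/8, 3/64)`), `|p| = 3`. -/
theorem sharp_delta_odd' : bev (triP 1 1 (-1) 1 1 1 3) (((3 : ℤ) : ℝ) / 2 ^ 3) ((-27 / 64 : ℚ) : ℝ) = 0 ∧
    bev (triP 1 1 (-1) 1 1 1 3) (((3 : ℤ) : ℝ) / 2 ^ 3) ((3 / 64 : ℚ) : ℝ) = 0 := by
  constructor <;> (rw [bev_triP]; push_cast; norm_num)

/-- `3 ≤ Δ` is needed: the NODAL cubic `Y² + x·Y + x³ = triP 1 1 1 1 1 1 2` (`Δ = 1` odd, primitive edges) passes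
through `(−3/4, −3/8)` (`|p| = 3`, `n = 2`; genus 0: `(−t² − t, t·x)`). -/
theorem sharp_three_le_delta : bev (triP 1 1 1 1 1 1 2) (((-3 : ℤ) : ℝ) / 2 ^ 2) ((-3 / 8 : ℚ) : ℝ) = 0 := by
  rw [bev_triP]; push_cast; norm_num

/-- `Odd p` is needed (the abscissa in LOWEST dyadic terms): `−Y² + 2x·Y − x⁵ = triP (−1) (1·2¹) (−1) 1 1 1 4 ∈ FermatTri`
(`Δ = 3`) passes through `(1, 1)`, and `1 = 2/2¹` with `p = 2` EVEN (in lowest terms `n = 0`, excluded by `1 ≤ n`). -/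
theorem sharp_odd_p : bev (triP (-1) (1 * 2 ^ 1) (-1) 1 1 1 4) (((2 : ℤ) : ℝ) / 2 ^ 1) ((1 : ℚ) : ℝ) = 0 := by
  rw [bev_triP]; push_cast; norm_num

/-- `: FermatTri (triP (-1) (1 * 2 ^ 1) (-1) 1 1 1 4)`. -/
theorem fermatTri_sharp_odd_p : FermatTri (triP (-1) (1 * 2 ^ 1) (-1) 1 1 1 4) :=
  fermatTri_triP (Or.inr rfl) (Or.inl rfl) (Or.inr rfl) (Δ := 3) one_pos one_pos (by norm_num) ⟨1, by norm_num⟩ le_rfl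
    (Nat.coprime_one_right _) (Nat.coprime_one_left _)

/-- `m ⊥ i` is needed: `Y⁴ + x³·Y − x⁵ = triP 1 1 (−1) 3 3 1 2` (`Δ = 3` odd, `k ⊥ l`, but `(m,i) = (3,3)`) passes

through `(9/16, 9/32)`, `|p| = 9`. -/
theorem sharp_coprime_mi : bev (triP 1 1 (-1) 3 3 1 2) (((9 : ℤ) : ℝ) / 2 ^ 4) ((9 / 32 : ℚ) : ℝ) = 0 := by
  rw [bev_triP]; push_cast; norm_num

/-- `k ⊥ l` is needed: `−Y⁵ + x·Y³ + x⁴ = triP (−1) 1 1 2 1 3 3` (`Δ = 3` odd, `m ⊥ i`, but `(k,l) = (3,3)`) passes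
through `(9/32, 9/16)`, `|p| = 9`. -/
theorem sharp_coprime_kl : bev (triP (-1) 1 1 2 1 3 3) (((9 : ℤ) : ℝ) / 2 ^ 5) ((9 / 16 : ℚ) : ℝ) = 0 := by
  rw [bev_triP]; push_cast; norm_num

end Sharpness

end Summit.Schanuel.Schanuel.Theorems.RootDecomp1KTrinomialDescent

end
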